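import Summits.CriticalPhenomena.PercolationContinuityZ3.Theorems.Transplant.GrigorchukLamplighterFCScope
import Summits.CriticalPhenomena.PercolationContinuityZ3.Theorems.Transplant.GrigorchukLamplighterSomeGens
import Literature.Probability.Percolation.CoveringQuotientMap
import HarnessLib

/-!
# NO COVERING BEHIND hC ON BARTHOLDI–ERSCHLER'S GRAPH: every subgroup of `Γ₂ = ℤ ≀_X 𝔊` with finite-index normaliser whose orbit map is injective on a
# block-sum cylinder is TRIVIAL — the covering route («AutCylinderCovering»: embed the cylinder in a quotient by a free action, then Martineau–Severo)
# has no instance on `Cay(ℤ ≀_X 𝔊; a,b,c,d,s)` beyond the lamp-frozen fibre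

builds on p205010 (kernel theorem, internal audit signed; external expert review pending) — nothing in this file uses p205010; pure group theory (no percolation
statement), no node touched.  Lane `prim-bschramm`, seat `prim-bschramm-p3` gen 37 (design owner; offer O15c(i), `P3-NILPOTENT.md` §30.2; lead g26 GO #8146).  Helper file
(`--supports stmt-CriticalPhenomena-4575 --as helper`).  Def-free.  NOTHING about `θ(p_c)` on B–E's graph (NOT PROVED in tree or print), nothing about the end state or growth.

THE POINT.  The covering route to the cylinder input hC («AutCylinderCovering» `qmk_injOn_cylinder` + `criticalProb_lt_criticalProb_quot`, Martineau–Severo Cor. 2.2)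
needs a subgroup `Λ` acting freely whose ORBIT MAP IS INJECTIVE on the cylinder and whose quotient is quasi-transitive — in Martineau–Severo's §3 Remark 2 setting, `Λ`
normalised by a finite-index (cocompact) subgroup.  On `Γ₂` acting on itself by left multiplication, with the block-sum cylinders
`{(f, g) : (Σ_{X₀} f, Σ_{X₁} f) ∈ B}` of the quasi-step datum (`0 ∈ B`, so the cylinder contains `1`):
**`Grigorchuk.eq_bot_of_injOn_blockCylinder`** — `Λ ≤ Γ₂` normalised by a finite-index `Γ″ ≤ Γ₂` and with `qmk Λ` injective on such a cylinder is `⊥`.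
PROOF. (a) An element of `Λ ∩ (⊕_X ℤ) ⋊ St(1)` with zero block sums lies in the cylinder together with `1`, in the same `Λ`-orbit: injectivity kills it — the block
character is INJECTIVE on `Λ⁺ = Λ ⊓ stabOneW` (`eq_one_of_blockSum_eq_zero`). (b) `blockChar` maps to an ABELIAN group, so the commutator of `λ ∈ Λ⁺` with any
`γ ∈ Γ″ ⊓ stabOneW` lies in `Λ⁺ ∩ ker blockChar = 1`: `λ` commutes with a finite-index subgroup, hence `λ = 1` by «GrigorchukLamplighterFCScope»
`wreathZ_not_finiteIndex_of_commuting` (p593551) — `Λ⁺ = ⊥` (`inf_stabOneW_eq_bot`). (c) `stabOneW` has index two (p584586 `stabOneW_index`): for `λ ∈ Λ`, the commutator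
with any `γ ∈ Γ″` lies in `Λ⁺ = ⊥` (`Subgroup.mul_mem_iff_of_index_two`), so `λ` commutes with `Γ″` and again `λ = 1`.  The statement holds for EVERY such cylinder, width
`0` included: at width `0` the covering route survives only on the CONNECTED COMPONENT of the cylinder — the lamp-frozen fibre, where the quotient by the whole lamp group
is injective («GrigorchukLamplighterStrictInequality» p624823) —, not on the cylinder; for widths `≥ 1` the cylinder is connected (pen, `P3-NILPOTENT.md` §30) and this
theorem leaves no covering input — what remains for widths `≥ 1` is graph–subgraph strictness of Men'shikov / Aizenman–Grimmett type (essential enhancements;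
OPEN for such quasi-transitive pairs).  Γ₂-level (translations); the Aut-level twin waits on the classification of `Aut(Cay)` (§29.2).
[cite: MartineauSevero2019, Cor. 2.2; §3 Remark 2 (G normal in a quasi-transitive group)] [cite: BartholdiErschler2012, §2, §3.1 (St(1))] [cite: BenjaminiSchramm1996, Question 1; §2]
[cite: Menshikov1987] [cite: AizenmanGrimmett1991]
-/

noncomputable section

namespace Summit.CriticalPhenomena.PercolationContinuityZ3.Theorems.Transplant

namespace Grigorchuk

open SemidirectProduct Literature.Probability.Percolation Literature.Probability.LatticeModels

/-! ## §1 Injectivity on the cylinder makes the block character injective on `Λ ∩ (⊕_X ℤ) ⋊ St(1)` -/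

/-- **An element of `Λ` in `(⊕_X ℤ) ⋊ St(1)` with zero block sums is trivial** when the orbit map of `Λ` is injective on a block-sum cylinder through `0`:
it lies in the cylinder together with `1`, in one `Λ`-orbit. [cite: MartineauSevero2019, §2 (the quotient map π); Cor. 2.2] -/
theorem eq_one_of_blockSum_eq_zero {Λ : Subgroup ↥wreathZ} {B : Finset (Site 2)} (h0 : (0 : Site 2) ∈ B)
    (hinj : Set.InjOn (qmk ↥Λ) {w : ↥wreathZ | blockSum (Multiplicative.toAdd ((w : LampGroup ℤ)).left) ∈ B})
    {l : ↥wreathZ} (hl : l ∈ Λ) (hb : blockSum (Multiplicative.toAdd ((l : LampGroup ℤ)).left) = 0) : l = 1 := by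
  refine hinj (show l ∈ {w : ↥wreathZ | _} by rw [Set.mem_setOf_eq, hb]; exact h0)
    (show (1 : ↥wreathZ) ∈ {w : ↥wreathZ | _} by rw [Set.mem_setOf_eq, Subgroup.coe_one, one_left, toAdd_one, map_zero]; exact h0) ?_
  rw [qmk_eq_iff]
  exact ⟨⟨l, hl⟩, by rw [Subgroup.smul_def, smul_eq_mul, mul_one]⟩

/-- The block sums of an element of `(⊕_X ℤ) ⋊ St(1)` are its block character. [folklore] -/
theorem blockSum_eq_toAdd_blockChar {x : ↥wreathZ} (hx : x ∈ stabOneW) :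
    blockSum (Multiplicative.toAdd ((x : LampGroup ℤ)).left) = Multiplicative.toAdd (blockChar ⟨x, hx⟩) := rfl

/-! ## §2 `Λ ∩ (⊕_X ℤ) ⋊ St(1)` is trivial: it commutes with a finite-index subgroup -/

/-- **`Λ ⊓ stabOneW = ⊥`**: an element `λ ∈ Λ ∩ (⊕_X ℤ) ⋊ St(1)` commutes with every `γ ∈ Γ″ ∩ (⊕_X ℤ) ⋊ St(1)` (their commutator lies in `Λ`, in `stabOneW`, and has
trivial block character — the target `ℤ²` is abelian — so it is `1` by §1); `Γ″ ⊓ stabOneW` has finite index, and no non-trivial element of `Γ₂` commutes with a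
finite-index subgroup (p593551). [cite: BartholdiErschler2012, §3.1] [cite: MartineauSevero2019, §3 Remark 2] -/
theorem eq_one_of_mem_inf_stabOneW {Λ Γ'' : Subgroup ↥wreathZ} [Γ''.FiniteIndex] (hnorm : ∀ γ ∈ Γ'', ∀ l ∈ Λ, γ * l * γ⁻¹ ∈ Λ)
    {B : Finset (Site 2)} (h0 : (0 : Site 2) ∈ B)
    (hinj : Set.InjOn (qmk ↥Λ) {w : ↥wreathZ | blockSum (Multiplicative.toAdd ((w : LampGroup ℤ)).left) ∈ B})
    {l : ↥wreathZ} (hl : l ∈ Λ) (hlS : l ∈ stabOneW) : l = 1 := by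
  haveI : stabOneW.FiniteIndex := Subgroup.finiteIndex_iff.2 (by rw [stabOneW_index]; decide)
  by_contra hne
  refine wreathZ_not_finiteIndex_of_commuting l hne (Γ'' ⊓ stabOneW) (fun n hn => ?_) inferInstance
  obtain ⟨hnΓ, hnS⟩ := Subgroup.mem_inf.1 hn
  -- the commutator `n l n⁻¹ l⁻¹` lies in `Λ ∩ stabOneW` with zero block sums
  have hcΛ : n * l * n⁻¹ * l⁻¹ ∈ Λ := Λ.mul_mem (hnorm n hnΓ l hl) (Λ.inv_mem hl)
  have hcS : n * l * n⁻¹ * l⁻¹ ∈ stabOneW := stabOneW.mul_mem (stabOneW.mul_mem (stabOneW.mul_mem hnS hlS) (stabOneW.inv_mem hnS)) (stabOneW.inv_mem hlS)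
  have hb : blockSum (Multiplicative.toAdd (((n * l * n⁻¹ * l⁻¹ : ↥wreathZ)) : LampGroup ℤ).left) = 0 := by
    rw [blockSum_eq_toAdd_blockChar hcS]
    have e : (⟨n * l * n⁻¹ * l⁻¹, hcS⟩ : ↥stabOneW) = ⟨n, hnS⟩ * ⟨l, hlS⟩ * ⟨n, hnS⟩⁻¹ * ⟨l, hlS⟩⁻¹ := rfl
    have e' : blockChar (⟨n, hnS⟩ * ⟨l, hlS⟩ * ⟨n, hnS⟩⁻¹ * ⟨l, hlS⟩⁻¹) = 1 := by
      rw [map_mul, map_mul, map_mul, map_inv, map_inv, mul_inv_cancel_comm, mul_inv_cancel]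
    rw [e, e', toAdd_one]
  have hc1 : n * l * n⁻¹ * l⁻¹ = 1 := eq_one_of_blockSum_eq_zero h0 hinj hcΛ hb
  rw [mul_inv_eq_one, mul_inv_eq_iff_eq_mul] at hc1
  exact hc1

/-! ## §3 Index-two descent: `Λ = ⊥` -/

/-- **NO COVERING BEHIND THE CYLINDERS OF B–E's GRAPH (translations).**  Let `Λ ≤ Γ₂ = ℤ ≀_X 𝔊` be normalised by a finite-index subgroup `Γ″` and suppose the
orbit map of the left action of `Λ` is INJECTIVE on a block-sum cylinder `{(f, g) : (Σ_{X₀} f, Σ_{X₁} f) ∈ B}` with `0 ∈ B` (any width, `0` included).  Then `Λ = ⊥`.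
So the covering route (free action, injective on the cylinder, cocompact normaliser ⇒ Martineau–Severo) has NO input on `Cay(ℤ ≀_X 𝔊; a,b,c,d,s)` except on the
connected component of the width-0 cylinder, the lamp-frozen fibre of p624823.  (§2 and the index-two descent: `λ²` and every commutator `[γ, λ]`, `γ ∈ Γ″`, lie in
`Λ ⊓ stabOneW = ⊥`, so `λ` commutes with `Γ″` and is `1` by p593551.) [cite: MartineauSevero2019, Cor. 2.2; §3 Remark 2]
[cite: BartholdiErschler2012, §3.1 ([𝔊 : St(1)] = 2)] [cite: BenjaminiSchramm1996, Question 1] -/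
theorem eq_bot_of_injOn_blockCylinder (Λ Γ'' : Subgroup ↥wreathZ) [Γ''.FiniteIndex] (hnorm : ∀ γ ∈ Γ'', ∀ l ∈ Λ, γ * l * γ⁻¹ ∈ Λ)
    (B : Finset (Site 2)) (h0 : (0 : Site 2) ∈ B)
    (hinj : Set.InjOn (qmk ↥Λ) {w : ↥wreathZ | blockSum (Multiplicative.toAdd ((w : LampGroup ℤ)).left) ∈ B}) : Λ = ⊥ := by
  rw [Subgroup.eq_bot_iff_forall]
  intro l hl
  by_contra hne
  have h2 : stabOneW.index = 2 := stabOneW_index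
  -- every commutator with `Γ″` lies in `Λ ⊓ stabOneW = ⊥`
  refine wreathZ_not_finiteIndex_of_commuting l hne Γ'' (fun n hn => ?_) inferInstance
  have hcΛ : n * l * n⁻¹ * l⁻¹ ∈ Λ := Λ.mul_mem (hnorm n hn l hl) (Λ.inv_mem hl)
  haveI : stabOneW.Normal := Subgroup.normal_of_index_eq_two h2
  have hconj : n * l * n⁻¹ ∈ stabOneW ↔ l ∈ stabOneW := by
    refine ⟨fun h => ?_, fun h => Subgroup.Normal.conj_mem inferInstance _ h n⟩
    have h' := Subgroup.Normal.conj_mem inferInstance (n * l * n⁻¹) h n⁻¹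
    rwa [inv_inv, ← mul_assoc, ← mul_assoc, inv_mul_cancel, one_mul, mul_assoc, inv_mul_cancel, mul_one] at h'
  have hcS : n * l * n⁻¹ * l⁻¹ ∈ stabOneW := by
    rw [Subgroup.mul_mem_iff_of_index_two h2, hconj, Subgroup.inv_mem_iff]
  have hc1 : n * l * n⁻¹ * l⁻¹ = 1 := eq_one_of_mem_inf_stabOneW hnorm h0 hinj hcΛ hcS
  rw [mul_inv_eq_one, mul_inv_eq_iff_eq_mul] at hc1
  exact hc1

/-- **The same for a NORMAL subgroup `Λ ⊴ Γ₂`** (normaliser all of `Γ₂`): injectivity of its orbit map on one block-sum cylinder through `0` forces `Λ = ⊥` — e.g. the lamp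
group `Σ_X ℤ` itself is injective only on the fibre, never on a cylinder. [cite: MartineauSevero2019, Cor. 2.2; §3 Remark 2] [cite: BartholdiErschler2012, §2] -/
theorem eq_bot_of_normal_of_injOn_blockCylinder (Λ : Subgroup ↥wreathZ) [Λ.Normal] (B : Finset (Site 2)) (h0 : (0 : Site 2) ∈ B)
    (hinj : Set.InjOn (qmk ↥Λ) {w : ↥wreathZ | blockSum (Multiplicative.toAdd ((w : LampGroup ℤ)).left) ∈ B}) : Λ = ⊥ :=
  eq_bot_of_injOn_blockCylinder Λ ⊤ (fun γ _ l hl => Subgroup.Normal.conj_mem inferInstance l hl γ) B h0 hinj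

end Grigorchuk

end Summit.CriticalPhenomena.PercolationContinuityZ3.Theorems.Transplant

end
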